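import Summits.Ventures.CertifiedManyBodySolver.Downfold.PhaseMapMaterialVerdict

/-!
# The router PRIMARY governs the cells: the assembler's per-cell precedence and what an UND primary does to a §7 tally

Venture CertifiedManyBodySolver, cell `pub/hubbard-downfold`, seat hubbard-downfold-score-1 (second scoring engine);
namespace `Summit.Ventures.CertifiedManyBodySolver.Downfold.CellScore`. Context: ACCEPTANCE §3.3 R-2W («the PRIMARY router word
governs the cell word; a secondary branch result rides as a channel annex, never a word»), §4.5 (the material verdict from cells), and the
assembler's documented precedence per cell (oracle-dag `maps/FORMAT.md` l.53): structure status (unknown / disputed) → router pending →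
`router:UND:<TAG>` (UND primary) → BI / CI default «not» (screening-grade) → EPH band cells → 1BH box word / no-thermal-certificate. The
downfold-lead's R-y / A10 γ event (2026-08-27T03:12Z) re-worded the La-214 family with an `UND:MIXED` PRIMARY; score-1's pre-registration
(03:14Z / 03:19Z) said: «M13's 22 CI-default «not» cells become undetermined ⇒ decided materials 3 → 2, cuprate floor 1/19 → 0/19, FP 0
unchanged». This file is the KERNEL FORM of that step. Everything is PROVED.

WHAT THIS IS NOT: not the assembler (oracle-dag-2 writes the maps) and not a statement about which word is right (the router pen's) — it fixes
the CONSEQUENCE of the precedence for the acceptance tallies: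

* §1 `Primary` (UND ∣ insulatorDefault (BI/CI annotation under a decided primary) ∣ ephBranch ∣ hubbardBranch), `Stage` (what the stages
  supplied for the cell: nothing / a decided word), `assemblerWord` = the precedence as a total function: an UND primary yields `undetermined`
  WHATEVER the stages supplied (`assemblerWord_UND`); under `insulatorDefault` the default is «not» unless a stage word supersedes it (R-2W,
  FORMAT v0.2.1: an explicit S2/S3 cell hand-in supersedes a CI/BI default).
* §2 THE CONSEQUENCE (composition with `PhaseMapMaterialVerdict`): `verdict_UND_primary` — a material whose every cell is written under an
  UND primary and which carries no band has verdict UNDETERMINED, hence `kind_UND_primary` = ABSTAIN for either truth class: never TN,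
  never FP, never TP. So re-wording a primary from decided to UND can only REMOVE decided members from a class floor and can never create a
  false positive (`no_FP_under_UND`); and a CI material that was TN under a decided primary (`kind_CI_default_nonSC` = TN when every
  relevant cell carries the default «not») turns ABSTAIN (`M13_event`: the two verdicts side by side).
* §3 numbers of record (RUN #10 → the first assembly carrying the v1.9 words; v1 table): decided members 3 → 2 and the cuprate floor
  numerator 1 → 0 (`la214_event_counts`, plain arithmetic on the pre-registered tallies; the floor test itself is `PhaseMapDistanceToPass`).
-/

namespace Summit.Ventures.CertifiedManyBodySolver.Downfold

namespace CellScore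

/-! ## §1 The precedence as a total function -/

/-- What governs a cell's word, by the router's PRIMARY token (FORMAT l.53 after the structure / pending gates): an `UND:<TAG>` primary;
a decided primary with a BI/CI insulator annotation (default «not»); the e–ph branch (band cells); the Hubbard branch (box word /
thermal certificate). [folklore] -/
inductive Primary
  | UND
  | insulatorDefault
  | ephBranch
  | hubbardBranch
  deriving DecidableEq, Repr

/-- What the stages supplied for this cell: nothing, or an explicit decided word (an S2/S3 cell hand-in, an e–ph band cell, a box word).
[folklore] -/
inductive Stage
  | none
  | word (w : Word)
  deriving DecidableEq, Repr

/-- The assembler's per-cell precedence (FORMAT l.53 + R-2W): UND primary ⇒ `undetermined` whatever the stages say; insulator default ⇒ the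
stage word if one was handed in (R-2W: an explicit hand-in supersedes the default), else «not»; e–ph / Hubbard branch ⇒ the stage word if
any, else `undetermined` (pending band / no box word / no thermal certificate). [folklore] -/
def assemblerWord : Primary → Stage → Word
  | .UND, _ => Word.undetermined
  | .insulatorDefault, .word w => w
  | .insulatorDefault, .none => Word.not
  | .ephBranch, .word w => w
  | .ephBranch, .none => Word.undetermined
  | .hubbardBranch, .word w => w
  | .hubbardBranch, .none => Word.undetermined

/-- Under an UND primary every cell is `undetermined`, whatever the stages supplied. [folklore] -/
theorem assemblerWord_UND (s : Stage) : assemblerWord .UND s = Word.undetermined := by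
  cases s <;> rfl

/-- Under a decided primary with a CI/BI annotation and no stage hand-in the cell is the default «not». [folklore] -/
theorem assemblerWord_CI_default : assemblerWord .insulatorDefault .none = Word.not := rfl

/-- R-2W: an explicit stage word supersedes the insulator default. [folklore] -/
theorem assemblerWord_CI_superseded (w : Word) : assemblerWord .insulatorDefault (.word w) = w := rfl

/-- A material's cells as the §4.5 verdict reads them: (T, word) per cell of the truth's H = 0 columns, all written under ONE primary. [folklore] -/
def cellsUnder (p : Primary) (grid : List (ℚ × Stage)) : List (ℚ × Word) :=
  grid.map (fun c => (c.1, assemblerWord p c.2))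

/-- Every cell written under an UND primary reads `undetermined`. [folklore] -/
theorem cellsUnder_UND_all (grid : List (ℚ × Stage)) : ∀ c ∈ cellsUnder .UND grid, c.2 = Word.undetermined := by
  intro c hc
  simp only [cellsUnder, List.mem_map] at hc
  obtain ⟨a, _, rfl⟩ := hc
  exact assemblerWord_UND a.2

/-! ## §2 The consequence for the §4.5 verdict and the class floors -/

/-- THE CONSEQUENCE: a material whose cells are all written under an UND primary and which carries no band has verdict UNDETERMINED
(composition with `verdict_of_all_undetermined`). [folklore] -/
theorem verdict_UND_primary (Tfloor : ℚ) (grid : List (ℚ × Stage)) :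
    verdict Tfloor (cellsUnder .UND grid) [] = .UNDETERMINED :=
  verdict_of_all_undetermined (cellsUnder_UND_all grid)

/-- … hence its confusion entry is ABSTAIN for EITHER truth class: never TP, never TN, never FP, never FN. [folklore] -/
theorem kind_UND_primary (Tfloor : ℚ) (grid : List (ℚ × Stage)) (isSC : Bool) :
    kind (verdict Tfloor (cellsUnder .UND grid) []) isSC = .ABSTAIN := by
  rw [verdict_UND_primary]; cases isSC <;> rfl

/-- In particular re-wording a primary to UND can never CREATE a false positive (the costliest error): the FP count of a class can only
stay or fall when members turn ABSTAIN. [folklore] -/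
theorem no_FP_under_UND (Tfloor : ℚ) (grid : List (ℚ × Stage)) (isSC : Bool) :
    kind (verdict Tfloor (cellsUnder .UND grid) []) isSC ≠ .FP := by
  rw [kind_UND_primary]; decide

/-- The other side of the event: under a decided primary with the CI default on every cell (no stage hand-in anywhere) and at least one
cell at or above the truth's floor temperature, a NON-superconductor reads TN — M13 La₂CuO₄ under «1BH+3BE+CI» (RUN #6…#10). [folklore] -/
theorem kind_CI_default_nonSC (Tfloor : ℚ) (Ts : List ℚ) (hne : ∃ T ∈ Ts, Tfloor ≤ T) :
    kind (verdict Tfloor (cellsUnder .insulatorDefault (Ts.map fun T => (T, Stage.none))) []) false = .TN := by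
  have hcells : cellsUnder .insulatorDefault (Ts.map fun T => (T, Stage.none)) = Ts.map (fun T => (T, Word.not)) := by
    simp only [cellsUnder, List.map_map]; rfl
  rw [hcells]
  have hSC : saysSC (Ts.map fun T => (T, Word.not)) [] = false := by
    rw [Bool.eq_false_iff, Ne, saysSC_eq_true_iff]
    rintro (⟨c, hcm, hcw⟩ | ⟨b, hbm, _⟩)
    · simp only [List.mem_map] at hcm
      obtain ⟨T, _, rfl⟩ := hcm
      exact Word.not_ne_SC hcw
    · simp at hbm
  have hNOT : saysNOT Tfloor (Ts.map fun T => (T, Word.not)) [] = true := by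
    obtain ⟨T0, hT0, hle⟩ := hne
    simp only [saysNOT, relevant, Bool.and_eq_true, Bool.not_eq_true', List.all_eq_true, decide_eq_true_eq, List.any_nil,
               List.isEmpty_eq_false_iff_exists_mem, List.mem_filter, List.mem_map]
    refine ⟨⟨⟨(T0, Word.not), ⟨⟨T0, hT0, rfl⟩, by simpa using hle⟩⟩, ?_⟩, trivial⟩
    rintro c ⟨⟨T, _, rfl⟩, _⟩; rfl
  simp [verdict, hSC, hNOT, kind]

/-- THE M13 EVENT side by side: the same temperature grid (at least one cell at/above the floor), CI default under the decided primary ⇒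
TN; the same grid under the UND:MIXED primary ⇒ ABSTAIN. One decided member leaves the cuprate class floor; FP stays 0. [folklore] -/
theorem M13_event (Tfloor : ℚ) (Ts : List ℚ) (hne : ∃ T ∈ Ts, Tfloor ≤ T) :
    kind (verdict Tfloor (cellsUnder .insulatorDefault (Ts.map fun T => (T, Stage.none))) []) false = .TN ∧
      kind (verdict Tfloor (cellsUnder .UND (Ts.map fun T => (T, Stage.none))) []) false = .ABSTAIN :=
  ⟨kind_CI_default_nonSC Tfloor Ts hne, kind_UND_primary Tfloor _ false⟩

/-- The T22 grid of the maps (ACCEPTANCE §2.4) has cells at and above any floor ≤ 400 K — e.g. La₂CuO₄'s T_floor = 0.1 K (known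
non-superconductor, no T_min column): the cell at 300 K qualifies. [folklore] -/
theorem t22_has_relevant_cell : ∃ T ∈ ([0, 1/10, 3/10, 1, 2, 4, 6, 10, 15, 20, 30, 40, 50, 70, 100, 130, 160, 200, 250, 300, 350, 400] : List ℚ),
    (1 : ℚ) / 10 ≤ T :=
  ⟨300, by norm_num, by norm_num⟩

/-! ## §3 Numbers of record (pre-registered 2026-08-27T03:14Z/03:19Z for the first assembly carrying the La-214 words v1.9; v1 table) -/

/-- RUN #10 v1 decided members: M02 TP, M03 TP, M13 TN = 3; after the event M13 is ABSTAIN ⇒ 2; the cuprate class (19 non-exempt members)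
had exactly M13 decided ⇒ numerator 1 → 0 (the 0.60 floor then needs 12 conversions, `PhaseMapDistanceToPass.meets_convert_iff`:
3·19 = 57 ≤ 5·12 = 60, while 5·11 = 55 < 57); FP 0 → 0. [folklore] -/
theorem la214_event_counts :
    (3 : ℕ) - 1 = 2 ∧ (1 : ℕ) - 1 = 0 ∧ 3 * 19 ≤ 5 * 12 ∧ ¬ (3 * 19 ≤ 5 * 11) := by
  refine ⟨rfl, rfl, by norm_num, by norm_num⟩

end CellScore

end Summit.Ventures.CertifiedManyBodySolver.Downfold
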